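import Summits.QuantumFields.BalabanUV.T4Continuum.Spine.NE1p.DressedRebornMuPart
import Summits.QuantumFields.BalabanUV.T4Continuum.Spine.NE1p.DressedSmallFieldOnCoresWitness

/-!
# T⁴ programme, spine estimate NE1′ (node O3b/H2) — WITNESS «THE RE-BORN μ-PART FIRES ON THE EXP-LINEAR DATUM — AND ITS EXPONENTIAL IS A
# CROSS-RATIO»: S56 §2's `rebornMuPart_locE_le_of_expLinear` (leaf-03 g14, p239964) APPLIED ONCE BY NAME — its decided applier — on W31's
# one-term family `c·e^{h}` (this lineage, p225108) read along the BI-PENCIL `h = (z.1·a + z.2)·w₀` of row NE5's table line `ℂ`; the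
# exponential of the bounded mixed difference IS the cross-ratio `(1+A₁₁)(1+A₀₀)∕((1+A₀₁)(1+A₁₀))` of the four dressed one-cube partition
# functions, whose defect FACTORISES `= c·(e^{μ·a·w₀} − 1)·(e^{w₀} − 1)` — so the re-born μ-part VANISHES IFF `μ·a = 0` and is LIVE at every
# `μ ≠ 0`, `a ≠ 0`

Cell `pub-balaban`, sub-cell `t4`, row NE1′ formalisation crew (`t4/formal/NE1p/LEAVES.md` row W⟨next⟩; INTENT `HOME/CLAIMS.log`
2026-08-20), unit `b2b-balaban-t4-ne1p-formalise-leaf-06` (LEAF PROVER 06, gen 13; lineage S7b∕S7c∕S8∕W4s∕W22∕W26∕W31∕W36∕W44∕W50∕W61∕W63∕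
W71).  ADDITIVE — imports S56 `Spine/NE1p/DressedRebornMuPart` (leaf-03 g14; → S33 → N0r∕N0q∕N0p∕N0j → the owner's `DressedSmallFieldAllowance`)
and W31 `Spine/NE1p/DressedSmallFieldOnCoresWitness` (this lineage, gen 8; → N0p, W24 `DressedSmallFieldTorusWitness`) ONLY — both LANDED;
ONE toy DATA `def` (`actB`, the bi-pencil reading of W31's activity) + theorems; 0 `def … : Prop`, 0 cite, 0 sorry; nothing of S56 ∕ S33 ∕
N0p ∕ W31 ∕ W24 ∕ row NE5 is restated — `rebornMuPart_locE_le_of_expLinear`, `termHistExpLinear_wTerm`, `wTerm`∕`wPhi`∕`wMeas`∕`wLam`,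
`terms`, `actW`, `actW_X₀`, `hact`, `hK`, `hR`, `cW`, `cW_pos`, `hL3`, `norm_wLam_le`, `norm_actW_X₀_lt_one`, `exp_locE_actW`,
`eq_zero_of_exp_eq_one`, `X₀`, `hsmall_torus`, `hrate_torus`, `prefactor_pos`, `torus_consts`, `K₀_four` are used BY NAME.

WHY.  S56 (leaf-03 g14) typed the μ-part OF the content-sourced part — the MIXED difference `E(μ,1) − E(0,1) − E(μ,0) + E(0,0)` of the dressed
output over (source, strength) — and bounded it by Schwarz iterated on the bidisc, at three levels: §1 abstract `E`, §2 exp-linear families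
along a table map `hc : ℂ × ℂ → Hist` ((B1a) discharged by row NE5's `TermHistExpLinear`), §3 cores with term-dependent polymer families.
Its ENDs have no applier (tree grep at INTENT: the five names occur in `Spine/NE1p/DressedRebornMuPart.lean` only).  W31 (this lineage) is
the tree's decided `TermHistExpLinear` datum BY THEOREM — one term `T(o,h) = c·e^{h}` over row NE5's `toyCarriers`, `Hist = ℂ`, the activity
`actW N c w₀ s` = `c·e^{s·w₀}` on W24's one-cube domain `X₀` — on which N0p's attached-part and μ-part ENDs fired (`attachedEnd_fires`,
`muEnd_fires`), each along ONE pencil.  Here the SAME datum is read along a BI-pencil and S56 §2 fires on it: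
* §1 `actB N ϱ a w₀ z := actW N (cW ϱ w₀) w₀ (z.1·a + z.2)` (toy DATA) — source direction `a·w₀`, content direction `w₀` (in `Hist = ℂ`
  every pair of directions is of this form); the bidisc `‖z.1‖ < μ₁`, `‖z.2‖ < ε∕σ` maps into W31's pencil disc `‖s‖ < ϱ := μ₁‖a‖ + ε∕σ`
  (`mem_pencilDisc`), so W31's class membership `hK`, table radius `hR`, `hact` and the (2.38)-shaped budget `hL3` (EQUALITY at `X₀`, weight
  `cW ϱ w₀ = A·e^{−ϱ‖w₀‖}`) apply BY NAME with `R₀ := ϱ‖w₀‖`;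
* §2 **`rebornEnd_fires`** — S56 §2 `rebornMuPart_locE_le_of_expLinear` APPLIED ONCE BY NAME at `(D, G) := (tsys 4 N, tgeometry 4 N)`,
  `hexp := termHistExpLinear_wTerm`, `hc z := (z.1·a + z.2)·w₀`, `(A, R, r₁, b₅) := ((e·K₀(64,8)·9·64)⁻¹, 2κ₀ + 2, 0, 0)` with W24's
  `hsmall_torus`∕`hrate_torus`; binders DISPLAYED: `0 < σ < ε`, `ϱ‖w₀‖ ≤ 2` (the bi-pencil stays in NE5's class of history radius `2`),
  `‖μ‖ < μ₁`; conclusion LITERAL; `rebornEnd_fires_closed`: `≤ 4·K₀(64,8)·‖μ‖·σ∕(μ₁·ε)` (`e·ν·c₁·K₀²·A = K₀(64,8)` by `torus_consts`∕`K₀_four`);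
* §3 GENUINE — **`exp_mixedDiff_mul`**: `exp(Δ)·(1+A₀₁)(1+A₁₀) = (1+A₁₁)(1+A₀₀)` where `Δ` is the bounded mixed difference and
  `A_z := actB … z X₀` (W31's `exp_locE_actW` — W24's `exp_locE_cube` — at the four corners, all inside the pencil disc for `w₀ ≠ 0`);
  **`crossDefect_eq`**: `(1+A₁₁)(1+A₀₀) − (1+A₀₁)(1+A₁₀) = c·(e^{μ·a·w₀} − 1)·(e^{w₀} − 1)` (the `c²` terms CANCEL — the defect of the
  cross-ratio is the PRODUCT of the source factor and the content factor); **`mixedDiff_eq_zero_iff`**: for a live content `w₀ ≠ 0`,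
  `Δ = 0 ↔ μ·a = 0` (W31's `eq_zero_of_exp_eq_one`: both exponents have norm `≤ 2 < 2π`); **`rebornMuPart_live`**: `Δ ≠ 0` whenever `μ ≠ 0`,
  `a ≠ 0`, `w₀ ≠ 0` — the END of §2 is exercised on a quantity that moves with BOTH the source and the content.

HONEST FRAMING.  A DECIDED TOY ([folklore]; 0 sorry; 0 citations; ONE toy DATA `def`, no `def … : Prop`): S56 §2 applied ONCE to W31's
THEOREM-backed instance of row NE5's structural SHAPE `TermHistExpLinear` over `toyCarriers` — NOT Bałaban's (2.14) terms, NOT a `BiCore` of the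
format of record (S56 §3 is NOT exercised here), NOT the substrate's slot activities; the cross-ratio identity and the factorisation are
algebra of OUR one-cube toy (`exp E[H]({0}) = 1 + H(X₀)`, W24), not a statement about print's cluster expansion; every constant is W24's ∕
pv22's located torus constant (`K₀(64,8)`, `ν = 9`, `c₁ = 64`, `κ₀ = 64·log 162`) or the toy's own letter; `a`, `w₀`, `μ₁`, `σ`, `ε` are
DISPLAYED binders — WHICH table direction is the observable's source `μ·(obs)` and which is a booked family's content 𝐖 are the owner's
READINGS (skeleton leaves L-R ∕ L-P), not asserted; `4K₀‖μ‖σ∕(μ₁ε)` is a READING of the dressed (w5) constant `c̄_μ` on the toy — (B1a)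
discharged BY THEOREM on the toy's shape, (w5) NOT discharged on Bałaban's densities; (B1b) ∕ (B3) ∕ (B5) NOT discharged ((B3) = G-ne9p2-5
UNPRINTED, shared with NE9; here `hL3` is MET because the weight is CHOSEN as `A·e^{−ϱ‖w₀‖}`); no numeral of [Balaban1988RGII] (2.14)∕(2.38)∕
(2.41) is asserted; 0 binders instantiated on Bałaban's densities; no wall item; the NE1′ wall wording of record v1.8 (T4-DAG v48; v49∕v50 carry
it verbatim) — words, not kind — does NOT move; R-t4r2-Q2 NOT met thereby; no internally-minted statement becomes a cited fact (ABSOLUTE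
RULE).  NE1′ ⇐ the named binders — NOT proved, NOT printed; spine PROVED 0∕9; count 9 unchanged.  Rung (B)+1 on ONE finite four-torus — NOT
infinite volume, NOT a mass gap, NOT OS on ℝ⁴, NOT Clay.
HONEST DEPENDENCY: continuum YM on T⁴ ⇐ BetaPertH ∧ nine spine estimates (0/9 proved); BetaPertH ⇐ (D1) ∧ (D4) ∧ CAP+tail; G-an2-4
gates asym, D1 and NE2/3/4.
-/

noncomputable section

namespace Summit.QuantumFields.BalabanUV.T4Continuum.NE1p.DressedRebornMuPartWitness

open Metric Set Complex MeasureTheory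
open scoped BigOperators
open Literature.MathematicalPhysics.QuantumFieldTheory.Balaban1983to89.T4InputCauchyRate (toyCarriers)
open Literature.MathematicalPhysics.QuantumFieldTheory.Balaban1983to89.T4InputCauchyRateSpecies (ballClass toyCtr)
open Literature.MathematicalPhysics.QuantumFieldTheory.Balaban1983to89.B13Resummation (locE)
open Literature.MathematicalPhysics.QuantumFieldTheory.Balaban1983to89.B12TreeDecay (K₀ K₀_pos)
open Literature.MathematicalPhysics.QuantumFieldTheory.Balaban1983to89.TreeLengthTorus (TDom tsys)
open Literature.MathematicalPhysics.QuantumFieldTheory.Balaban1983to89.TreeLengthTorusGeometry (tgeometry)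
open Summit.QuantumFields.BalabanUV.T4Continuum.NE1p.DressedSmallFieldGeometry (torus_consts)
open Summit.QuantumFields.BalabanUV.T4Continuum.NE1p.DressedSmallFieldGeometryFaces (K₀_four)
open Summit.QuantumFields.BalabanUV.T4Continuum.NE1p.DressedSmallFieldTorusWitness (X₀ hsmall_torus hrate_torus prefactor_pos)
open Summit.QuantumFields.BalabanUV.T4Continuum.NE1p.DressedSmallFieldOnCoresWitness (wTerm wMeas wPhi wLam termHistExpLinear_wTerm
  norm_wLam_le terms actW actW_X₀ hact hR hK cW cW_pos hL3 norm_actW_X₀_lt_one exp_locE_actW eq_zero_of_exp_eq_one)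
open Summit.QuantumFields.BalabanUV.T4Continuum.NE1p.DressedRebornMuPart (rebornMuPart_locE_le_of_expLinear)

variable (N : ℕ) [NeZero N]

/-! ## §1 W31's ACTIVITY READ ALONG THE BI-PENCIL `h = (z.1·a + z.2)·w₀` — source direction `a·w₀`, content direction `w₀` -/

/-- THE BI-PENCIL ACTIVITY (toy DATA): W31's dressed activity `actW N (cW ϱ w₀) w₀ s` — `c·e^{s·w₀}` on `X₀`, `0` elsewhere, weight
`c = cW ϱ w₀ = A·e^{−ϱ‖w₀‖}` — read at the pencil parameter `s := z.1·a + z.2`: source coordinate `z.1` along `a·w₀`, strength coordinate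
`z.2` along `w₀`. [folklore] -/
def actB (ϱ : ℝ) (a w₀ : ℂ) (z : ℂ × ℂ) : TDom 4 N → ℂ := actW N (cW ϱ w₀) w₀ (z.1 * a + z.2)

/-- The bi-pencil activity on `X₀`: `c·e^{(z.1·a + z.2)·w₀}`. [folklore] -/
@[simp] theorem actB_X₀ (ϱ : ℝ) (a w₀ : ℂ) (z : ℂ × ℂ) :
    actB N ϱ a w₀ z (X₀ N) = (cW ϱ w₀ : ℂ) * cexp ((z.1 * a + z.2) * w₀) := by
  unfold actB; rw [actW_X₀]

/-- **THE BIDISC MAPS INTO W31's PENCIL DISC**: for `‖z.1‖ < μ₁` and `‖z.2‖ < ρ₂`, `‖z.1·a + z.2‖ < μ₁‖a‖ + ρ₂`. [folklore] -/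
theorem mem_pencilDisc {μ₁ ρ₂ : ℝ} {a : ℂ} {z : ℂ × ℂ} (hz : z ∈ ball (0 : ℂ) μ₁ ×ˢ ball (0 : ℂ) ρ₂) :
    z.1 * a + z.2 ∈ ball (0 : ℂ) (μ₁ * ‖a‖ + ρ₂) := by
  rw [mem_ball_zero_iff]
  obtain ⟨h1, h2⟩ := hz
  rw [mem_ball_zero_iff] at h1 h2
  calc ‖z.1 * a + z.2‖ ≤ ‖z.1 * a‖ + ‖z.2‖ := norm_add_le _ _
    _ = ‖z.1‖ * ‖a‖ + ‖z.2‖ := by rw [norm_mul]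
    _ < μ₁ * ‖a‖ + ρ₂ := add_lt_add_of_le_of_lt (mul_le_mul_of_nonneg_right h1.le (norm_nonneg a)) h2

/-- The table map `z ↦ (z.1·a + z.2)·w₀` is jointly holomorphic. [folklore] -/
theorem differentiableOn_bipencil (a w₀ : ℂ) (S : Set (ℂ × ℂ)) :
    DifferentiableOn ℂ (fun z : ℂ × ℂ => (z.1 * a + z.2) * w₀) S :=
  (((differentiable_fst.mul_const a).add differentiable_snd).mul_const w₀).differentiableOn

/-! ## §2 THE END FIRES: S56 §2 `rebornMuPart_locE_le_of_expLinear` APPLIED ONCE BY NAME on W31's datum -/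

open Classical in
/-- **S56 §2's `rebornMuPart_locE_le_of_expLinear` FIRES ON W31's EXP-LINEAR DATUM ALONG THE BI-PENCIL** [decided toy]: `(D, G) :=
(tsys 4 N, tgeometry 4 N)`; `hexp := termHistExpLinear_wTerm` (row NE5's shape BY THEOREM, NE5's ball class, window `univ`); table map
`hc z := (z.1·a + z.2)·w₀` on the bidisc `‖z.1‖ < μ₁`, `‖z.2‖ < ε∕σ`; class membership, table radius `R₀ := ϱ‖w₀‖`, `hact` and the
(2.38)-shaped budget `hL3` are W31's `hK`∕`hR`∕`hact`∕`hL3` BY NAME at the pencil radius `ϱ := μ₁‖a‖ + ε∕σ` (`mem_pencilDisc`); read-out bound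
`N := 1` (`norm_wLam_le`); `(A, R, r₁, b₅) := ((e·K₀(64,8)·9·64)⁻¹, 2κ₀ + 2, 0, 0)` with W24's `hrate_torus`∕`hsmall_torus`.  DISPLAYED:
`0 < σ < ε`, `ϱ·‖w₀‖ ≤ 2`, `‖μ‖ < μ₁`.  Conclusion LITERAL. [folklore] -/
theorem rebornEnd_fires {a w₀ : ℂ} {μ₁ σ ε : ℝ} (hσ : 0 < σ) (hσε : σ < ε)
    (hw : (μ₁ * ‖a‖ + ε / σ) * ‖w₀‖ ≤ 2) (k : ℕ) (g : ℕ → ℝ) {μ : ℂ} (hμ : ‖μ‖ < μ₁) :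
    ‖locE (tgeometry 4 N).ι (tgeometry 4 N).cubes (actB N (μ₁ * ‖a‖ + ε / σ) a w₀ (μ, 1)) ((tgeometry 4 N).cubes (X₀ N)) -
          locE (tgeometry 4 N).ι (tgeometry 4 N).cubes (actB N (μ₁ * ‖a‖ + ε / σ) a w₀ (0, 1)) ((tgeometry 4 N).cubes (X₀ N)) -
        (locE (tgeometry 4 N).ι (tgeometry 4 N).cubes (actB N (μ₁ * ‖a‖ + ε / σ) a w₀ (μ, 0)) ((tgeometry 4 N).cubes (X₀ N)) -
          locE (tgeometry 4 N).ι (tgeometry 4 N).cubes (actB N (μ₁ * ‖a‖ + ε / σ) a w₀ (0, 0)) ((tgeometry 4 N).cubes (X₀ N)))‖ ≤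
      2 * (2 * (Real.exp 1 * (tgeometry 4 N).ν * (tgeometry 4 N).c₁ * (tgeometry 4 N).K₀ ^ 2 * (Real.exp 1 * K₀ 64 8 * 9 * 64)⁻¹ *
        Real.exp (-(0 * (tsys 4 N).dj (X₀ N)))) / μ₁ * ‖μ‖) / ε * σ :=
  rebornMuPart_locE_le_of_expLinear (tsys 4 N) (tgeometry 4 N)
    (termHistExpLinear_wTerm (cW (μ₁ * ‖a‖ + ε / σ) w₀) (ballClass toyCtr (fun _ => 1 / 8) fun _ => 2) Set.univ)
    (Set.mem_univ g) (U := ()) (o := 0) (hc := fun z : ℂ × ℂ => (z.1 * a + z.2) * w₀) (R₀ := (μ₁ * ‖a‖ + ε / σ) * ‖w₀‖) hσ hσε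
    (differentiableOn_bipencil a w₀ _) (fun z hz => hK hw k g () (z.1 * a + z.2) (mem_pencilDisc hz))
    (fun z hz => hR (μ₁ * ‖a‖ + ε / σ) w₀ (z.1 * a + z.2) (mem_pencilDisc hz))
    (emb := fun _ => k) (fun _ => rfl) (terms := terms N) (act := actB N (μ₁ * ‖a‖ + ε / σ) a w₀)
    (fun z _ Z => hact N (cW (μ₁ * ‖a‖ + ε / σ) w₀) w₀ k (z.1 * a + z.2) Z) (N := fun _ _ => 1) (fun _ _ => zero_le_one)
    (fun _ i _ => ae_of_all _ fun x => norm_wLam_le k i 0 k x)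
    (A := (Real.exp 1 * K₀ 64 8 * 9 * 64)⁻¹) (R := 2 * (tgeometry 4 N).κ₀ + 2) (r₁ := 0) (b₅ := 0) (X₀ := X₀ N)
    (inv_nonneg.2 prefactor_pos.le) le_rfl (by rw [zero_mul]) (hrate_torus N) (hsmall_torus N)
    (hL3 N (μ₁ * ‖a‖ + ε / σ) w₀ k _) (mem_ball_zero_iff.2 hμ)

open Classical in
/-- … in CLOSED FORM: the re-born μ-part is `≤ 4·K₀(64,8)·‖μ‖·σ∕(μ₁·ε)` (`e·ν·c₁·K₀²·A = K₀(64,8)` by `torus_consts`∕`K₀_four`; decay factor `1`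
on the one cube) — BILINEAR in the source increment `‖μ‖` and the content size `σ`, the DRESSED regeneration constant of S56 read on the
toy. [folklore] -/
theorem rebornEnd_fires_closed {a w₀ : ℂ} {μ₁ σ ε : ℝ} (hσ : 0 < σ) (hσε : σ < ε)
    (hw : (μ₁ * ‖a‖ + ε / σ) * ‖w₀‖ ≤ 2) (k : ℕ) (g : ℕ → ℝ) {μ : ℂ} (hμ : ‖μ‖ < μ₁) :
    ‖locE (tgeometry 4 N).ι (tgeometry 4 N).cubes (actB N (μ₁ * ‖a‖ + ε / σ) a w₀ (μ, 1)) ((tgeometry 4 N).cubes (X₀ N)) -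
          locE (tgeometry 4 N).ι (tgeometry 4 N).cubes (actB N (μ₁ * ‖a‖ + ε / σ) a w₀ (0, 1)) ((tgeometry 4 N).cubes (X₀ N)) -
        (locE (tgeometry 4 N).ι (tgeometry 4 N).cubes (actB N (μ₁ * ‖a‖ + ε / σ) a w₀ (μ, 0)) ((tgeometry 4 N).cubes (X₀ N)) -
          locE (tgeometry 4 N).ι (tgeometry 4 N).cubes (actB N (μ₁ * ‖a‖ + ε / σ) a w₀ (0, 0)) ((tgeometry 4 N).cubes (X₀ N)))‖ ≤
      4 * K₀ 64 8 * ‖μ‖ * σ / (μ₁ * ε) := by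
  have hμ₁ : 0 < μ₁ := (norm_nonneg μ).trans_lt hμ
  have hε : 0 < ε := hσ.trans hσε
  have h := rebornEnd_fires N hσ hσε hw k g hμ
  rw [zero_mul, neg_zero, Real.exp_zero, mul_one, K₀_four, (torus_consts N).1, (torus_consts N).2.2] at h
  refine h.trans (le_of_eq ?_)
  have hK : K₀ (64 : ℝ) 8 ≠ 0 := (K₀_pos _ _).ne'
  have he : Real.exp 1 ≠ 0 := (Real.exp_pos 1).ne'
  field_simp
  ring

/-! ## §3 GENUINE — THE EXPONENTIAL OF THE RE-BORN μ-PART IS A CROSS-RATIO, AND ITS DEFECT FACTORISES -/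

section Genuine
variable {a w₀ : ℂ} {μ₁ σ ε : ℝ} {μ : ℂ}

/-- The four corners `μ·a + 1`, `0·a + 1`, `μ·a + 0`, `0·a + 0` of the bi-pencil lie STRICTLY inside W31's pencil disc of radius
`ϱ = μ₁‖a‖ + ε∕σ` (`‖μ‖ < μ₁`, `1 < ε∕σ`). [folklore] -/
theorem corners_mem (hσ : 0 < σ) (hσε : σ < ε) (hμ : ‖μ‖ < μ₁) :
    ‖μ * a + 1‖ < μ₁ * ‖a‖ + ε / σ ∧ ‖(0 : ℂ) * a + 1‖ < μ₁ * ‖a‖ + ε / σ ∧ ‖μ * a + 0‖ < μ₁ * ‖a‖ + ε / σ ∧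
      ‖(0 : ℂ) * a + 0‖ < μ₁ * ‖a‖ + ε / σ := by
  have hμ₁ : 0 ≤ μ₁ := (norm_nonneg μ).trans hμ.le
  have h1 : 1 < ε / σ := (one_lt_div hσ).2 hσε
  have ha : ‖μ * a‖ ≤ μ₁ * ‖a‖ := by rw [norm_mul]; exact mul_le_mul_of_nonneg_right hμ.le (norm_nonneg a)
  have hpos : 0 ≤ μ₁ * ‖a‖ := mul_nonneg hμ₁ (norm_nonneg a)
  refine ⟨?_, ?_, ?_, ?_⟩
  · calc ‖μ * a + 1‖ ≤ ‖μ * a‖ + ‖(1 : ℂ)‖ := norm_add_le _ _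
      _ = ‖μ * a‖ + 1 := by rw [norm_one]
      _ < μ₁ * ‖a‖ + ε / σ := add_lt_add_of_le_of_lt ha h1
  · rw [zero_mul, zero_add, norm_one]; linarith
  · rw [add_zero]; linarith
  · rw [zero_mul, add_zero, norm_zero]; linarith

open Classical in
/-- **THE EXPONENTIAL OF THE RE-BORN μ-PART IS THE CROSS-RATIO OF THE FOUR DRESSED ONE-CUBE PARTITION FUNCTIONS** [decided toy]: with
`A_z := actB … z X₀` and `Δ` the mixed difference bounded by `rebornEnd_fires`, `exp(Δ)·((1+A₀₁)·(1+A₁₀)) = (1+A₁₁)·(1+A₀₀)` — W31's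
`exp_locE_actW` (W24's `exp E[H]({0}) = 1 + H(X₀)`) at the four corners, for a live content direction `w₀ ≠ 0`. [folklore] -/
theorem exp_mixedDiff_mul (hσ : 0 < σ) (hσε : σ < ε) (hw0 : w₀ ≠ 0) (hμ : ‖μ‖ < μ₁) :
    cexp (locE (tgeometry 4 N).ι (tgeometry 4 N).cubes (actB N (μ₁ * ‖a‖ + ε / σ) a w₀ (μ, 1)) ((tgeometry 4 N).cubes (X₀ N)) -
          locE (tgeometry 4 N).ι (tgeometry 4 N).cubes (actB N (μ₁ * ‖a‖ + ε / σ) a w₀ (0, 1)) ((tgeometry 4 N).cubes (X₀ N)) -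
        (locE (tgeometry 4 N).ι (tgeometry 4 N).cubes (actB N (μ₁ * ‖a‖ + ε / σ) a w₀ (μ, 0)) ((tgeometry 4 N).cubes (X₀ N)) -
          locE (tgeometry 4 N).ι (tgeometry 4 N).cubes (actB N (μ₁ * ‖a‖ + ε / σ) a w₀ (0, 0)) ((tgeometry 4 N).cubes (X₀ N)))) *
        ((1 + actB N (μ₁ * ‖a‖ + ε / σ) a w₀ (0, 1) (X₀ N)) * (1 + actB N (μ₁ * ‖a‖ + ε / σ) a w₀ (μ, 0) (X₀ N))) =
      (1 + actB N (μ₁ * ‖a‖ + ε / σ) a w₀ (μ, 1) (X₀ N)) * (1 + actB N (μ₁ * ‖a‖ + ε / σ) a w₀ (0, 0) (X₀ N)) := by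
  obtain ⟨c11, c01, c10, c00⟩ := corners_mem (a := a) hσ hσε hμ
  have e11 := exp_locE_actW N c11 hw0
  have e01 := exp_locE_actW N c01 hw0
  have e10 := exp_locE_actW N c10 hw0
  have e00 := exp_locE_actW N c00 hw0
  unfold actB
  rw [Complex.exp_sub, Complex.exp_sub, Complex.exp_sub, e11, e01, e10, e00, div_div_div_eq]
  -- the two denominators are dressed one-cube partition functions `1 + A` with `‖A‖ < 1`, hence nonzero
  have h01 : (1 : ℂ) + actW N (cW (μ₁ * ‖a‖ + ε / σ) w₀) w₀ (0 * a + 1) (X₀ N) ≠ 0 := fun h => by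
    have hA : actW N (cW (μ₁ * ‖a‖ + ε / σ) w₀) w₀ (0 * a + 1) (X₀ N) = -1 := by linear_combination h
    have hlt := norm_actW_X₀_lt_one N c01 hw0
    rw [hA, norm_neg, norm_one] at hlt
    exact lt_irrefl _ hlt
  have h10 : (1 : ℂ) + actW N (cW (μ₁ * ‖a‖ + ε / σ) w₀) w₀ (μ * a + 0) (X₀ N) ≠ 0 := fun h => by
    have hA : actW N (cW (μ₁ * ‖a‖ + ε / σ) w₀) w₀ (μ * a + 0) (X₀ N) = -1 := by linear_combination h
    have hlt := norm_actW_X₀_lt_one N c10 hw0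
    rw [hA, norm_neg, norm_one] at hlt
    exact lt_irrefl _ hlt
  exact div_mul_cancel₀ _ (mul_ne_zero h01 h10)

/-- **THE CROSS DEFECT FACTORISES** [decided toy]: `(1+A₁₁)·(1+A₀₀) − (1+A₀₁)·(1+A₁₀) = c·(e^{μ·a·w₀} − 1)·(e^{w₀} − 1)`, `c = cW ϱ w₀` — the
`c²` terms cancel (`e^{(μa+1)w₀} = e^{μaw₀}·e^{w₀}`), and what is left is the PRODUCT of the source factor and the content factor. [folklore] -/
theorem crossDefect_eq (ϱ : ℝ) :
    (1 + actB N ϱ a w₀ (μ, 1) (X₀ N)) * (1 + actB N ϱ a w₀ (0, 0) (X₀ N)) -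
        (1 + actB N ϱ a w₀ (0, 1) (X₀ N)) * (1 + actB N ϱ a w₀ (μ, 0) (X₀ N)) =
      (cW ϱ w₀ : ℂ) * (cexp (μ * a * w₀) - 1) * (cexp w₀ - 1) := by
  simp only [actB_X₀]
  rw [show (μ * a + 1) * w₀ = μ * a * w₀ + w₀ by ring, Complex.exp_add, show ((0 : ℂ) * a + 1) * w₀ = w₀ by ring,
    show (μ * a + 0) * w₀ = μ * a * w₀ by ring, show ((0 : ℂ) * a + 0) * w₀ = 0 by ring, Complex.exp_zero]
  ring

/-- The two exponents have norm `≤ 2` on the booked bidisc (`ϱ‖w₀‖ ≤ 2`, `ϱ = μ₁‖a‖ + ε∕σ ≥ μ₁‖a‖` and `≥ 1`): `‖μ·a·w₀‖ ≤ 2` and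
`‖w₀‖ ≤ 2` — so neither is a nonzero period of `exp`. [folklore] -/
theorem norm_exponents_le (hσ : 0 < σ) (hσε : σ < ε) (hw : (μ₁ * ‖a‖ + ε / σ) * ‖w₀‖ ≤ 2) (hμ : ‖μ‖ < μ₁) :
    ‖μ * a * w₀‖ ≤ 2 ∧ ‖w₀‖ ≤ 2 := by
  have hμ₁ : 0 ≤ μ₁ := (norm_nonneg μ).trans hμ.le
  have h1 : 1 ≤ ε / σ := ((one_lt_div hσ).2 hσε).le
  have hpos : 0 ≤ μ₁ * ‖a‖ := mul_nonneg hμ₁ (norm_nonneg a)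
  have hw₀ : 0 ≤ ‖w₀‖ := norm_nonneg _
  refine ⟨?_, ?_⟩
  · calc ‖μ * a * w₀‖ = ‖μ‖ * ‖a‖ * ‖w₀‖ := by rw [norm_mul, norm_mul]
      _ ≤ μ₁ * ‖a‖ * ‖w₀‖ := by gcongr
      _ ≤ (μ₁ * ‖a‖ + ε / σ) * ‖w₀‖ := by nlinarith
      _ ≤ 2 := hw
  · nlinarith

open Classical in
/-- **THE RE-BORN μ-PART VANISHES IFF THE SOURCE DOES NOT MOVE THE TABLE** [decided toy]: for a live content direction `w₀ ≠ 0` (and the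
booked bidisc), the mixed difference bounded by `rebornEnd_fires` is `0 ↔ μ·a = 0`.  (⇒) `exp Δ = 1` turns `exp_mixedDiff_mul` into «cross
defect `= 0`», i.e. `c·(e^{μaw₀} − 1)·(e^{w₀} − 1) = 0` by `crossDefect_eq`; `c ≠ 0`, and by W31's `eq_zero_of_exp_eq_one` (norms `≤ 2`) a
vanishing factor forces `μ·a·w₀ = 0` or `w₀ = 0`.  (⇐) `μ·a = 0` makes the source corners coincide with the base corners. [folklore] -/
theorem mixedDiff_eq_zero_iff (hσ : 0 < σ) (hσε : σ < ε) (hw : (μ₁ * ‖a‖ + ε / σ) * ‖w₀‖ ≤ 2) (hw0 : w₀ ≠ 0) (hμ : ‖μ‖ < μ₁) :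
    locE (tgeometry 4 N).ι (tgeometry 4 N).cubes (actB N (μ₁ * ‖a‖ + ε / σ) a w₀ (μ, 1)) ((tgeometry 4 N).cubes (X₀ N)) -
          locE (tgeometry 4 N).ι (tgeometry 4 N).cubes (actB N (μ₁ * ‖a‖ + ε / σ) a w₀ (0, 1)) ((tgeometry 4 N).cubes (X₀ N)) -
        (locE (tgeometry 4 N).ι (tgeometry 4 N).cubes (actB N (μ₁ * ‖a‖ + ε / σ) a w₀ (μ, 0)) ((tgeometry 4 N).cubes (X₀ N)) -
          locE (tgeometry 4 N).ι (tgeometry 4 N).cubes (actB N (μ₁ * ‖a‖ + ε / σ) a w₀ (0, 0)) ((tgeometry 4 N).cubes (X₀ N))) = 0 ↔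
      μ * a = 0 := by
  constructor
  · intro hΔ
    have hmul := exp_mixedDiff_mul N (a := a) hσ hσε hw0 hμ
    rw [hΔ, Complex.exp_zero, one_mul] at hmul
    -- the cross defect vanishes, hence one factor does
    have hdef := crossDefect_eq N (a := a) (w₀ := w₀) (μ := μ) (μ₁ * ‖a‖ + ε / σ)
    rw [← hmul, sub_self] at hdef
    have hc : (cW (μ₁ * ‖a‖ + ε / σ) w₀ : ℂ) ≠ 0 := by exact_mod_cast (cW_pos _ w₀).ne'
    obtain ⟨hn1, hn2⟩ := norm_exponents_le (a := a) hσ hσε hw hμ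
    rcases mul_eq_zero.1 hdef.symm with h | h
    · rcases mul_eq_zero.1 h with h' | h'
      · exact absurd h' hc
      · have h0 := eq_zero_of_exp_eq_one hn1 (sub_eq_zero.1 h')
        rcases mul_eq_zero.1 h0 with h1 | h1
        · exact h1
        · exact absurd h1 hw0
    · exact absurd (eq_zero_of_exp_eq_one hn2 (sub_eq_zero.1 h)) hw0
  · intro h
    have e1 : actB N (μ₁ * ‖a‖ + ε / σ) a w₀ (μ, 1) = actB N (μ₁ * ‖a‖ + ε / σ) a w₀ (0, 1) := by
      unfold actB; simp only [h, zero_mul]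
    have e0 : actB N (μ₁ * ‖a‖ + ε / σ) a w₀ (μ, 0) = actB N (μ₁ * ‖a‖ + ε / σ) a w₀ (0, 0) := by
      unfold actB; simp only [h, zero_mul]
    rw [e1, e0, sub_self, sub_self, sub_self]

open Classical in
/-- **GENUINE — THE RE-BORN μ-PART MOVES WITH BOTH THE SOURCE AND THE CONTENT** [decided toy]: for `μ ≠ 0`, `a ≠ 0` and a live content
direction `w₀ ≠ 0` (booked bidisc), the quantity bounded by `rebornEnd_fires` is `≠ 0`. [folklore] -/
theorem rebornMuPart_live (hσ : 0 < σ) (hσε : σ < ε) (hw : (μ₁ * ‖a‖ + ε / σ) * ‖w₀‖ ≤ 2) (hw0 : w₀ ≠ 0) (hμ : ‖μ‖ < μ₁)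
    (hne : μ ≠ 0) (ha : a ≠ 0) :
    locE (tgeometry 4 N).ι (tgeometry 4 N).cubes (actB N (μ₁ * ‖a‖ + ε / σ) a w₀ (μ, 1)) ((tgeometry 4 N).cubes (X₀ N)) -
          locE (tgeometry 4 N).ι (tgeometry 4 N).cubes (actB N (μ₁ * ‖a‖ + ε / σ) a w₀ (0, 1)) ((tgeometry 4 N).cubes (X₀ N)) -
        (locE (tgeometry 4 N).ι (tgeometry 4 N).cubes (actB N (μ₁ * ‖a‖ + ε / σ) a w₀ (μ, 0)) ((tgeometry 4 N).cubes (X₀ N)) -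
          locE (tgeometry 4 N).ι (tgeometry 4 N).cubes (actB N (μ₁ * ‖a‖ + ε / σ) a w₀ (0, 0)) ((tgeometry 4 N).cubes (X₀ N))) ≠ 0 :=
  fun h => (mul_ne_zero hne ha) ((mixedDiff_eq_zero_iff N hσ hσε hw hw0 hμ).1 h)

/-- **THE BOOKED BIDISC IS INHABITED WITH A LIVE DATUM** [located]: at `a = w₀ = 1∕2`, `μ₁ = 1`, `σ = 1`, `ε = 2` the pencil radius is
`ϱ = ½ + 2 = 5∕2` and `ϱ‖w₀‖ = 5∕4 ≤ 2`; with `μ = ½` all three liveness conditions hold. -/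
example : ((1 : ℝ) * ‖(1 / 2 : ℂ)‖ + 2 / 1) * ‖(1 / 2 : ℂ)‖ ≤ 2 ∧ ‖(1 / 2 : ℂ)‖ < 1 ∧ (1 / 2 : ℂ) ≠ 0 := by
  refine ⟨?_, ?_, by norm_num⟩ <;> norm_num

end Genuine

end Summit.QuantumFields.BalabanUV.T4Continuum.NE1p.DressedRebornMuPartWitness

end
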